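import Literature.MathematicalPhysics.QuantumLattice.GrassmannFlowGeometricMajorants
import Literature.MathematicalPhysics.QuantumLattice.GrassmannEffectiveActionTruncationDB
import HarnessLib

/-!
# The flow of majorants for DETERMINANT-BOUNDED slices (twin of `GrassmannFlowIterationSplit` and
# `GrassmannFlowGeometricMajorants`)

Topic `MathematicalPhysics/QuantumLattice`; continuation of `GrassmannEffectiveActionTruncationDB`.  The iterated single-scale step with
a tracked linear part (`iterEffAction_splitFlow`) and its scalar form with geometric degree profile (`iterEffAction_splitFlow_geometric`;
Benfatto–Giuliani–Mastropietro 2006, (2.77)–(2.80), (2.86)–(2.90); Gawȩdzki–Kupiainen 1985, §3) re-run VERBATIM with the per-slice Gram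
form replaced by the replica-stable hypothesis `IsGramBoundedR (C j) (κ j)` of `GrassmannDeterminantBounded`.  Gram slices satisfy it
(`isGramBoundedR_of_gram`), and so does a slice whose two-point function only obeys the Pedra–Salmhofer determinant bound
(`IsDetBoundedR.isGramBoundedR`) — so ONE flow can integrate a chronological ultraviolet slice followed by Gram infrared slices:

* `sum_norm_kernel_gaussConv_le_normV_of_gramBounded` (first cumulant in `‖·‖_h` form),
* `iterEffAction_splitFlow_of_gramBounded`, **`iterEffAction_splitFlow_geometric_of_gramBounded`**.

Everything is proved; no definition, no named fact.

## Sources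

G. Benfatto, A. Giuliani, V. Mastropietro, Ann. Henri Poincaré 7 (2006) 809–898, (2.77)–(2.80), (2.86)–(2.90)
[`BenfattoGiulianiMastropietro2006`]; K. Gawȩdzki, A. Kupiainen, Comm. Math. Phys. 102 (1985) 1–30, §3 [`GawedzkiKupiainen1985GrossNeveu`];
W. de Siqueira Pedra, M. Salmhofer, Comm. Math. Phys. 282 (2008) 797–818, Thm 2.4 [`PedraSalmhofer2008`].
-/

noncomputable section

namespace Literature.MathematicalPhysics.QuantumLattice

open GrassmannAlgebra Finset Literature.Probability.LatticeModels
open scoped InnerProductSpace Nat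

universe u

variable {𝕜 : Type*} [RCLike 𝕜] {Γ : Type u} [Fintype Γ] [DecidableEq Γ]

/-- (Twin of `sum_norm_kernel_gaussConv_le_normV` under `IsGramBoundedR`.) **The linear part of the renormalisation-group map in Gram form** (the first cumulant of
`GrassmannCumulantActionBound.sum_norm_kernel_cumulantOf_le_pow`; Benfatto–Giuliani–Mastropietro 2006, (2.77)–(2.80) at first
order): for an even `H` with pinned kernel norms `≤ N(m')` in degree `2m'`, a charged covariance in Gram form with constant
`κ` and an output field weight `ρ > 0`, in every degree `m` with one output label pinned,
`Σ_{W : W_i = w} ‖kernel_m (e^{Δ_C} H) (W)‖ ≤ ρ^{-m} · e · ‖H‖_h`, `‖H‖_h = Σ_{m'} (e²(κ+ρ))^{2m'} N(m')` — no count of Wick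
pairings, hence no factorial in the degree. [cite: BenfattoGiulianiMastropietro2006, (2.77)-(2.80)] -/
theorem sum_norm_kernel_gaussConv_le_normV_of_gramBounded (C : Matrix Γ Γ 𝕜) {κ : ℝ} (hκ : 0 < κ) (hGB : IsGramBoundedR C κ)
    (H : GrassmannAlgebra 𝕜 Γ) (hH : H ∈ evenPart 𝕜 Γ) (N : ℕ → ℝ) (hN0 : ∀ m', 0 ≤ N m')
    (hN : ∀ m' (j : Fin (2 * m')) (w : Γ), ∑ Y ∈ univ.filter (fun Y : Fin (2 * m') → Γ => Y j = w), ‖kernel 𝕜 H (2 * m') Y‖ ≤ N m')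
    {α : ℝ} (hα : 0 < α) (hrow : ∀ X, ∑ Y, ‖C X Y‖ ≤ α) (hcol : ∀ Y, ∑ X, ‖C X Y‖ ≤ α) {ρ : ℝ} (hρ : 0 < ρ)
    {m : ℕ} (i : Fin m) (w : Γ) :
    ∑ W ∈ univ.filter (fun W : Fin m → Γ => W i = w), ‖kernel 𝕜 (gaussConv 𝕜 C H) m W‖ ≤
      ρ⁻¹ ^ m * (Real.exp 1 * normV Γ κ ρ N) := by
  set X : evenPart 𝕜 Γ := ⟨H, hH⟩ with hX
  set degs : Finset ℕ := range (Fintype.card Γ / 2 + 1) with hdegs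
  set K : (m' : ℕ) → (Fin (2 * m') → Γ) → 𝕜 := fun m' => kernel 𝕜 H (2 * m') with hK
  have hXv : vertexOf 𝕜 degs K = X := Subtype.ext (coe_vertexOf_kernel_eq 𝕜 X)
  have h := sum_norm_kernel_cumulantOf_le_pow_of_gramBounded C hκ hGB degs K N hN0 (fun m' j w' => hN m' j w') hα hrow hcol
    hρ one_pos i w
  have hcum : ((cumulantOf (fun k => evenGaussConv 𝕜 C (vertexOf 𝕜 degs K ^ k)) 1 : evenPart 𝕜 Γ) : GrassmannAlgebra 𝕜 Γ) =
      gaussConv 𝕜 C H := by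
    rw [cumulantOf_one, pow_one, hXv, coe_evenGaussConv]
  rw [hcum] at h
  refine h.trans (le_of_eq ?_)
  have hnV : ∑ m' ∈ degs, (Real.exp 2 * (κ + ρ)) ^ (2 * m') * N m' = normV Γ κ ρ N := rfl
  rw [hnV]
  simp only [Nat.factorial_one, Nat.cast_one, one_mul, Nat.sub_self, mul_zero, pow_zero, pow_one]
  ring

/-- (Twin of `iterEffAction_splitFlow` under `IsGramBoundedR`.) **Iterating the single-scale step with a tracked linear part.**  Slices `C 0, C 1, …` on one label set, charged for the
same charge map `q` and in Gram form on the mixed pairs (constants `κ j`, vectors `f j, g j`), with row and column sums of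
`‖C j‖` at most `α j` and output field weights `ρ j`; an even interaction `V` without constant part; a TRACKED sequence
`L j` of even elements whose kernels of positive degree flow linearly
(`kernel_m (e^{Δ_{C j}} L_j) = kernel_m L_{j+1}`, `m ≥ 1` — e.g. the explicit Wick images of the local quartic and quadratic
terms) with pinned norms `≤ NL j m`; and majorants `NH j m ≥ 0` of the untracked part with `NH 0 ≥` the pinned norms of
`V - L 0`, and for every slice `j < K`: `θ_j = e α_j ‖·‖_{h_j}[NL j + NH j]/κ_j² < 1` and
`NH (j+1) m ≥ ρ_j^{-m} e ‖·‖_{h_j}[NH j] + ρ_j^{-m} e ‖·‖_{h_j}[NL j + NH j] θ_j/(1 - θ_j)` for `m ≥ 1` (first cumulant of the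
untracked part in Gram form + the second-order remainder of the whole).  Then for every `n ≤ K`: the single-slice partition
functions `∫dμ_{C j} e^{-V^{(j)}}`, `j < n`, are units; `V^{(n)} = iterEffAction C n V` is even without constant part; and
`Σ_{Y : Y_p = w} ‖kernel (V^{(n)} - L n) m Y‖ ≤ NH n m` for all `m ≥ 1`, `p`, `w` (Benfatto–Giuliani–Mastropietro 2006,
(2.86)–(2.90): away from the tracked part everything moves at second order). [cite: BenfattoGiulianiMastropietro2006, (2.77)-(2.80) and (2.86)-(2.90)] -/
theorem iterEffAction_splitFlow_of_gramBounded (C : ℕ → Matrix Γ Γ 𝕜) (κ : ℕ → ℝ) (hκ : ∀ j, 0 < κ j) (hGB : ∀ j, IsGramBoundedR (C j) (κ j))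
    (α : ℕ → ℝ) (hα : ∀ j, 0 < α j) (hrow : ∀ j X, ∑ Y, ‖C j X Y‖ ≤ α j) (hcol : ∀ j Y, ∑ X, ‖C j X Y‖ ≤ α j)
    (ρ : ℕ → ℝ) (hρ : ∀ j, 0 < ρ j)
    (V : GrassmannAlgebra 𝕜 Γ) (hV : V ∈ evenPart 𝕜 Γ) (hV0 : constPart 𝕜 V = 0)
    (L : ℕ → GrassmannAlgebra 𝕜 Γ) (hL : ∀ j, L j ∈ evenPart 𝕜 Γ)
    (hLflow : ∀ j, ∀ m, 0 < m → ∀ Y : Fin m → Γ, kernel 𝕜 (gaussConv 𝕜 (C j) (L j)) m Y = kernel 𝕜 (L (j + 1)) m Y)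
    (NL NH : ℕ → ℕ → ℝ) (hNL0 : ∀ j m, 0 ≤ NL j m) (hNH0 : ∀ j m, 0 ≤ NH j m)
    (hNL : ∀ (j m : ℕ) (p : Fin m) (w : Γ), ∑ Y ∈ univ.filter (fun Y : Fin m → Γ => Y p = w), ‖kernel 𝕜 (L j) m Y‖ ≤ NL j m)
    (hNHV : ∀ (m : ℕ) (p : Fin m) (w : Γ),
      ∑ Y ∈ univ.filter (fun Y : Fin m → Γ => Y p = w), ‖kernel 𝕜 (V - L 0) m Y‖ ≤ NH 0 m)
    (K : ℕ)
    (hθ : ∀ j < K, Real.exp 1 * α j * normV Γ (κ j) (ρ j) (fun m' => NL j (2 * m') + NH j (2 * m')) / κ j ^ 2 < 1)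
    (hstep : ∀ j < K, ∀ m, 0 < m →
      (ρ j)⁻¹ ^ m * (Real.exp 1 * normV Γ (κ j) (ρ j) (fun m' => NH j (2 * m'))) +
        (ρ j)⁻¹ ^ m * (Real.exp 1 * normV Γ (κ j) (ρ j) (fun m' => NL j (2 * m') + NH j (2 * m'))) *
          (Real.exp 1 * α j * normV Γ (κ j) (ρ j) (fun m' => NL j (2 * m') + NH j (2 * m')) / κ j ^ 2) /
            (1 - Real.exp 1 * α j * normV Γ (κ j) (ρ j) (fun m' => NL j (2 * m') + NH j (2 * m')) / κ j ^ 2) ≤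
        NH (j + 1) m) :
    ∀ n ≤ K, (∀ j < n, IsUnit (effPartitionFn 𝕜 (C j) (iterEffAction 𝕜 C j V))) ∧
      iterEffAction 𝕜 C n V ∈ evenPart 𝕜 Γ ∧ constPart 𝕜 (iterEffAction 𝕜 C n V) = 0 ∧
      ∀ (m : ℕ), 0 < m → ∀ (p : Fin m) (w : Γ),
        ∑ Y ∈ univ.filter (fun Y : Fin m → Γ => Y p = w), ‖kernel 𝕜 (iterEffAction 𝕜 C n V - L n) m Y‖ ≤ NH n m := by
  intro n
  induction n with
  | zero =>
    intro _
    refine ⟨fun j hj => absurd hj (Nat.not_lt_zero j), ?_, ?_, ?_⟩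
    · rw [iterEffAction_zero]; exact hV
    · rw [iterEffAction_zero]; exact hV0
    · intro m _ p w; rw [iterEffAction_zero]; exact hNHV m p w
  | succ n ih =>
    intro hn
    have hnK : n < K := Nat.lt_of_succ_le hn
    obtain ⟨hunits, heven, hconst, hker⟩ := ih hnK.le
    set Vn := iterEffAction 𝕜 C n V with hVn
    -- the pinned norms of `V^{(n)} = L n + (V^{(n)} - L n)`
    have hNV : ∀ (m : ℕ) (p : Fin m) (w : Γ),
        ∑ Y ∈ univ.filter (fun Y : Fin m → Γ => Y p = w), ‖kernel 𝕜 Vn m Y‖ ≤ NL n m + NH n m := by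
      intro m p w
      rcases Nat.eq_zero_or_pos m with rfl | hm
      · exact absurd p.2 (Nat.not_lt_zero _)
      · have hsplit : ∀ Y, kernel 𝕜 Vn m Y = kernel 𝕜 (L n) m Y + kernel 𝕜 (Vn - L n) m Y := by
          intro Y; rw [← kernel_add]; congr 1; abel
        calc ∑ Y ∈ univ.filter (fun Y : Fin m → Γ => Y p = w), ‖kernel 𝕜 Vn m Y‖
            ≤ ∑ Y ∈ univ.filter (fun Y : Fin m → Γ => Y p = w), (‖kernel 𝕜 (L n) m Y‖ + ‖kernel 𝕜 (Vn - L n) m Y‖) :=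
              sum_le_sum fun Y _ => by rw [hsplit Y]; exact norm_add_le _ _
          _ ≤ NL n m + NH n m := by rw [sum_add_distrib]; exact add_le_add (hNL n m p w) (hker m hm p w)
    have hN2 : ∀ (m' : ℕ) (j : Fin (2 * m')) (w : Γ),
        ∑ Y ∈ univ.filter (fun Y : Fin (2 * m') → Γ => Y j = w), ‖kernel 𝕜 Vn (2 * m') Y‖ ≤ NL n (2 * m') + NH n (2 * m') :=
      fun m' j w => hNV (2 * m') j w
    -- the second-order remainder of the whole and the unit
    obtain ⟨hunit, hrem⟩ := sum_norm_kernel_effAction_sub_gaussConv_le_of_gramBounded (C n) (hκ n) (hGB n)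
      Vn heven hconst (fun m' => NL n (2 * m') + NH n (2 * m')) (fun m' => add_nonneg (hNL0 n _) (hNH0 n _)) hN2 (hα n)
      (hrow n) (hcol n) (hρ n) (hθ n hnK)
    -- the first cumulant of the untracked part, in Gram form
    have hH : Vn - L n ∈ evenPart 𝕜 Γ := Subalgebra.sub_mem _ heven (hL n)
    have hlin : ∀ {m : ℕ} (p : Fin m) (w : Γ),
        ∑ Y ∈ univ.filter (fun Y : Fin m → Γ => Y p = w), ‖kernel 𝕜 (gaussConv 𝕜 (C n) (Vn - L n)) m Y‖ ≤
          (ρ n)⁻¹ ^ m * (Real.exp 1 * normV Γ (κ n) (ρ n) (fun m' => NH n (2 * m'))) := by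
      intro m p w
      refine sum_norm_kernel_gaussConv_le_normV_of_gramBounded (C n) (hκ n) (hGB n) (Vn - L n) hH
        (fun m' => NH n (2 * m')) (fun m' => hNH0 n _) (fun m' j w' => ?_) (hα n) (hrow n) (hcol n) (hρ n) p w
      rcases Nat.eq_zero_or_pos m' with rfl | hm'
      · exact absurd j.2 (by simp)
      · exact hker (2 * m') (by omega) j w'
    refine ⟨fun j hj => ?_, ?_, ?_, ?_⟩
    · rcases Nat.lt_succ_iff_lt_or_eq.1 hj with hj' | rfl
      · exact hunits j hj'
      · exact hunit
    · rw [iterEffAction_succ]; exact effAction_mem_evenPart (C n) heven hconst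
    · rw [iterEffAction_succ]; exact constPart_effAction 𝕜 (C n) Vn hunit
    · intro m hm p w
      rw [iterEffAction_succ]
      -- `V^{(n+1)} - L (n+1) = (effAction - e^{Δ}V^{(n)}) + e^{Δ}(V^{(n)} - L n)` in every positive degree
      have hsplit : ∀ Y : Fin m → Γ, kernel 𝕜 (effAction 𝕜 (C n) Vn - L (n + 1)) m Y =
          kernel 𝕜 (effAction 𝕜 (C n) Vn - gaussConv 𝕜 (C n) Vn) m Y + kernel 𝕜 (gaussConv 𝕜 (C n) (Vn - L n)) m Y := by
        intro Y
        have hL' : kernel 𝕜 (L (n + 1)) m Y = kernel 𝕜 (gaussConv 𝕜 (C n) (L n)) m Y := (hLflow n m hm Y).symm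
        have e1 : effAction 𝕜 (C n) Vn - L (n + 1) = (effAction 𝕜 (C n) Vn - gaussConv 𝕜 (C n) Vn) +
            (gaussConv 𝕜 (C n) (Vn - L n)) + (gaussConv 𝕜 (C n) (L n) - L (n + 1)) := by
          rw [map_sub]; abel
        rw [e1, kernel_add, kernel_add, show gaussConv 𝕜 (C n) (L n) - L (n + 1) =
          gaussConv 𝕜 (C n) (L n) + (-1 : 𝕜) • L (n + 1) by rw [neg_one_smul, sub_eq_add_neg], kernel_add, kernel_smul,
          hL']
        ring
      calc ∑ Y ∈ univ.filter (fun Y : Fin m → Γ => Y p = w), ‖kernel 𝕜 (effAction 𝕜 (C n) Vn - L (n + 1)) m Y‖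
          ≤ ∑ Y ∈ univ.filter (fun Y : Fin m → Γ => Y p = w), (‖kernel 𝕜 (effAction 𝕜 (C n) Vn - gaussConv 𝕜 (C n) Vn) m Y‖ +
              ‖kernel 𝕜 (gaussConv 𝕜 (C n) (Vn - L n)) m Y‖) :=
            sum_le_sum fun Y _ => by rw [hsplit Y]; exact norm_add_le _ _
        _ ≤ (ρ n)⁻¹ ^ m * (Real.exp 1 * normV Γ (κ n) (ρ n) (fun m' => NL n (2 * m') + NH n (2 * m'))) *
              (Real.exp 1 * α n * normV Γ (κ n) (ρ n) (fun m' => NL n (2 * m') + NH n (2 * m')) / κ n ^ 2) /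
                (1 - Real.exp 1 * α n * normV Γ (κ n) (ρ n) (fun m' => NL n (2 * m') + NH n (2 * m')) / κ n ^ 2) +
            (ρ n)⁻¹ ^ m * (Real.exp 1 * normV Γ (κ n) (ρ n) (fun m' => NH n (2 * m'))) := by
            rw [sum_add_distrib]; exact add_le_add (hrem hm p w) (hlin p w)
        _ ≤ NH (n + 1) m := by linarith [hstep n hnK m hm]

omit [DecidableEq Γ] in
/-- `‖·‖_h` is additive in the pinned norms. [folklore] -/
private theorem normV_add (κ ρ : ℝ) (N₁ N₂ : ℕ → ℝ) :
    normV Γ κ ρ (fun m' => N₁ m' + N₂ m') = normV Γ κ ρ N₁ + normV Γ κ ρ N₂ := by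
  simp only [normV, mul_add, sum_add_distrib]

/-- (Twin of `iterEffAction_splitFlow_geometric` under `IsGramBoundedR`.) **The split flow with geometric majorants** (scalar form of `iterEffAction_splitFlow`).  Slices `C j` charged for `q`
and in Gram form (`κ j`, `f j`, `g j`), row/column sums `≤ α j`, output weights `ρ j`; an even `V` without constant part; a
tracked part `L j` (even, positive-degree kernels flowing linearly, pinned norms `≤ NL j`, field-weighted norm
`‖·‖_{h_j}[NL j] ≤ Λ j`); real sequences `D, t ≥ 0` with `t (j+1) = (ρ j)⁻¹`, the pinned norms of `V - L 0` at most
`D 0 · (t 0)^m`, and for every `j < K`, with `x_j = e²(κ_j + ρ_j) t_j`, `D̃_j = D_j/(1 - x_j²)`, `θ_j = e α_j (Λ_j + D̃_j)/κ_j²`: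
`x_j < 1`, `θ_j < 1` and `D (j+1) ≥ e (D̃_j + (Λ_j + D̃_j) θ_j/(1 - θ_j))`.  Then for every `n ≤ K`: the single-slice
partition functions below `n` are units, `V^{(n)} = iterEffAction C n V` is even without constant part, and
`Σ_{Y : Y_p = w} ‖kernel (V^{(n)} - L n) m Y‖ ≤ D_n t_n^m` for `m ≥ 1` — the un-renormalised multiscale expansion reduced to
a recursion of real numbers (Benfatto–Giuliani–Mastropietro 2006, (2.77)–(2.80), (2.86)–(2.90)).
[cite: BenfattoGiulianiMastropietro2006, (2.77)-(2.80) and (2.86)-(2.90)] -/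
theorem iterEffAction_splitFlow_geometric_of_gramBounded (C : ℕ → Matrix Γ Γ 𝕜) (κ : ℕ → ℝ) (hκ : ∀ j, 0 < κ j) (hGB : ∀ j, IsGramBoundedR (C j) (κ j))
    (α : ℕ → ℝ) (hα : ∀ j, 0 < α j) (hrow : ∀ j X, ∑ Y, ‖C j X Y‖ ≤ α j) (hcol : ∀ j Y, ∑ X, ‖C j X Y‖ ≤ α j)
    (ρ : ℕ → ℝ) (hρ : ∀ j, 0 < ρ j)
    (V : GrassmannAlgebra 𝕜 Γ) (hV : V ∈ evenPart 𝕜 Γ) (hV0 : constPart 𝕜 V = 0)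
    (L : ℕ → GrassmannAlgebra 𝕜 Γ) (hL : ∀ j, L j ∈ evenPart 𝕜 Γ)
    (hLflow : ∀ j, ∀ m, 0 < m → ∀ Y : Fin m → Γ, kernel 𝕜 (gaussConv 𝕜 (C j) (L j)) m Y = kernel 𝕜 (L (j + 1)) m Y)
    (NL : ℕ → ℕ → ℝ) (hNL0 : ∀ j m, 0 ≤ NL j m)
    (hNL : ∀ (j m : ℕ) (p : Fin m) (w : Γ), ∑ Y ∈ univ.filter (fun Y : Fin m → Γ => Y p = w), ‖kernel 𝕜 (L j) m Y‖ ≤ NL j m)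
    (Λ : ℕ → ℝ) (hΛ : ∀ j, normV Γ (κ j) (ρ j) (fun m' => NL j (2 * m')) ≤ Λ j)
    (D t : ℕ → ℝ) (hD0 : ∀ j, 0 ≤ D j) (ht0 : ∀ j, 0 ≤ t j) (ht : ∀ j, t (j + 1) = (ρ j)⁻¹)
    (hNHV : ∀ (m : ℕ) (p : Fin m) (w : Γ),
      ∑ Y ∈ univ.filter (fun Y : Fin m → Γ => Y p = w), ‖kernel 𝕜 (V - L 0) m Y‖ ≤ D 0 * t 0 ^ m)
    (K : ℕ) (hx : ∀ j < K, Real.exp 2 * (κ j + ρ j) * t j < 1)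
    (hθ : ∀ j < K, Real.exp 1 * α j * (Λ j + D j / (1 - (Real.exp 2 * (κ j + ρ j) * t j) ^ 2)) / κ j ^ 2 < 1)
    (hstep : ∀ j < K,
      Real.exp 1 * (D j / (1 - (Real.exp 2 * (κ j + ρ j) * t j) ^ 2) +
        (Λ j + D j / (1 - (Real.exp 2 * (κ j + ρ j) * t j) ^ 2)) *
          (Real.exp 1 * α j * (Λ j + D j / (1 - (Real.exp 2 * (κ j + ρ j) * t j) ^ 2)) / κ j ^ 2) /
            (1 - Real.exp 1 * α j * (Λ j + D j / (1 - (Real.exp 2 * (κ j + ρ j) * t j) ^ 2)) / κ j ^ 2)) ≤ D (j + 1)) :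
    ∀ n ≤ K, (∀ j < n, IsUnit (effPartitionFn 𝕜 (C j) (iterEffAction 𝕜 C j V))) ∧
      iterEffAction 𝕜 C n V ∈ evenPart 𝕜 Γ ∧ constPart 𝕜 (iterEffAction 𝕜 C n V) = 0 ∧
      ∀ (m : ℕ), 0 < m → ∀ (p : Fin m) (w : Γ),
        ∑ Y ∈ univ.filter (fun Y : Fin m → Γ => Y p = w), ‖kernel 𝕜 (iterEffAction 𝕜 C n V - L n) m Y‖ ≤ D n * t n ^ m := by
  -- the geometric majorants and the scalar quantities
  set NH : ℕ → ℕ → ℝ := fun j m => D j * t j ^ m with hNH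
  have hNH0 : ∀ j m, 0 ≤ NH j m := fun j m => by rw [hNH]; exact mul_nonneg (hD0 j) (pow_nonneg (ht0 j) m)
  have hκρ : ∀ j, 0 ≤ κ j + ρ j := fun j => (add_pos (hκ j) (hρ j)).le
  -- `‖·‖_{h_j}[NH j] ≤ D̃_j` and `‖·‖_{h_j}[NL j + NH j] ≤ Λ_j + D̃_j`
  have hnH : ∀ j < K, normV Γ (κ j) (ρ j) (fun m' => NH j (2 * m')) ≤
      D j / (1 - (Real.exp 2 * (κ j + ρ j) * t j) ^ 2) := fun j hj => by
    simpa only [hNH] using normV_geometric_le (Γ := Γ) (hκρ j) (ht0 j) (hD0 j) (hx j hj)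
  have hnLH : ∀ j < K, normV Γ (κ j) (ρ j) (fun m' => NL j (2 * m') + NH j (2 * m')) ≤
      Λ j + D j / (1 - (Real.exp 2 * (κ j + ρ j) * t j) ^ 2) := fun j hj => by
    rw [normV_add]; exact add_le_add (hΛ j) (hnH j hj)
  have hnLH0 : ∀ j, 0 ≤ normV Γ (κ j) (ρ j) (fun m' => NL j (2 * m') + NH j (2 * m')) :=
    fun j => normV_nonneg (hκ j).le (hρ j).le fun m' => add_nonneg (hNL0 j _) (hNH0 j _)
  have hnH0' : ∀ j, 0 ≤ normV Γ (κ j) (ρ j) (fun m' => NH j (2 * m')) :=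
    fun j => normV_nonneg (hκ j).le (hρ j).le fun m' => hNH0 j _
  -- the true `θ` is below the scalar `θ_j`
  have hθtrue : ∀ j < K, Real.exp 1 * α j * normV Γ (κ j) (ρ j) (fun m' => NL j (2 * m') + NH j (2 * m')) / κ j ^ 2 ≤
      Real.exp 1 * α j * (Λ j + D j / (1 - (Real.exp 2 * (κ j + ρ j) * t j) ^ 2)) / κ j ^ 2 := fun j hj => by
    have := hnLH j hj
    have hκ2 : 0 < κ j ^ 2 := pow_pos (hκ j) 2
    have he : 0 < Real.exp 1 * α j := mul_pos (Real.exp_pos 1) (hα j)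
    exact div_le_div_of_nonneg_right (mul_le_mul_of_nonneg_left this he.le) hκ2.le
  refine iterEffAction_splitFlow_of_gramBounded C κ hκ hGB α hα hrow hcol ρ hρ V hV hV0 L hL hLflow NL NH hNL0 hNH0 hNL
    (fun m p w => by simpa only [hNH] using hNHV m p w) K (fun j hj => (hθtrue j hj).trans_lt (hθ j hj)) ?_
  -- the one-step inequality at the geometric majorant
  intro j hj m hm
  set θt : ℝ := Real.exp 1 * α j * normV Γ (κ j) (ρ j) (fun m' => NL j (2 * m') + NH j (2 * m')) / κ j ^ 2 with hθt
  set θs : ℝ := Real.exp 1 * α j * (Λ j + D j / (1 - (Real.exp 2 * (κ j + ρ j) * t j) ^ 2)) / κ j ^ 2 with hθs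
  set Dt : ℝ := D j / (1 - (Real.exp 2 * (κ j + ρ j) * t j) ^ 2) with hDt
  have hθt0 : 0 ≤ θt := by rw [hθt]; exact div_nonneg (mul_nonneg (mul_nonneg (Real.exp_pos 1).le (hα j).le) (hnLH0 j)) (sq_nonneg _)
  have hθts : θt ≤ θs := hθtrue j hj
  have hθs1 : θs < 1 := hθ j hj
  have hfrac : θt / (1 - θt) ≤ θs / (1 - θs) := by
    rw [div_le_div_iff₀ (by linarith) (by linarith)]
    nlinarith
  have hfrac0 : 0 ≤ θt / (1 - θt) := div_nonneg hθt0 (by linarith)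
  have hρm : 0 < (ρ j)⁻¹ ^ m := pow_pos (inv_pos.2 (hρ j)) m
  have hA : Real.exp 1 * normV Γ (κ j) (ρ j) (fun m' => NH j (2 * m')) ≤ Real.exp 1 * Dt :=
    mul_le_mul_of_nonneg_left (hnH j hj) (Real.exp_pos 1).le
  have hB : Real.exp 1 * normV Γ (κ j) (ρ j) (fun m' => NL j (2 * m') + NH j (2 * m')) * θt / (1 - θt) ≤
      Real.exp 1 * (Λ j + Dt) * (θs / (1 - θs)) := by
    rw [mul_div_assoc]
    exact mul_le_mul (mul_le_mul_of_nonneg_left (hnLH j hj) (Real.exp_pos 1).le) hfrac hfrac0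
      (mul_nonneg (Real.exp_pos 1).le ((hnLH0 j).trans (hnLH j hj)))
  have hDnext : Real.exp 1 * (Dt + (Λ j + Dt) * θs / (1 - θs)) ≤ D (j + 1) := by
    simpa only [hDt, hθs] using hstep j hj
  -- assemble
  have hgoal : (ρ j)⁻¹ ^ m * (Real.exp 1 * normV Γ (κ j) (ρ j) (fun m' => NH j (2 * m'))) +
      (ρ j)⁻¹ ^ m * (Real.exp 1 * normV Γ (κ j) (ρ j) (fun m' => NL j (2 * m') + NH j (2 * m'))) * θt / (1 - θt) ≤
      (ρ j)⁻¹ ^ m * D (j + 1) := by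
    have e1 : (ρ j)⁻¹ ^ m * (Real.exp 1 * normV Γ (κ j) (ρ j) (fun m' => NL j (2 * m') + NH j (2 * m'))) * θt / (1 - θt) =
        (ρ j)⁻¹ ^ m * (Real.exp 1 * normV Γ (κ j) (ρ j) (fun m' => NL j (2 * m') + NH j (2 * m')) * θt / (1 - θt)) := by
      ring
    rw [e1, ← mul_add]
    refine mul_le_mul_of_nonneg_left ((add_le_add hA hB).trans ?_) hρm.le
    calc Real.exp 1 * Dt + Real.exp 1 * (Λ j + Dt) * (θs / (1 - θs))
        = Real.exp 1 * (Dt + (Λ j + Dt) * θs / (1 - θs)) := by ring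
      _ ≤ D (j + 1) := hDnext
  calc _ ≤ (ρ j)⁻¹ ^ m * D (j + 1) := hgoal
    _ = NH (j + 1) m := by rw [hNH]; dsimp only; rw [ht j, mul_comm]

end Literature.MathematicalPhysics.QuantumLattice

end
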